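/-
Copyright: H21 programme, solo seat `solo-RiemannHypothesis-informed` (session 4).
-/
import Summits.RiemannHypothesis.RiemannHypothesis.Theorems.SoloInformedDodging
import Literature.NumberTheory.LFunctions.ZetaZeroBoxEnumeration
import Literature.NumberTheory.LFunctions.MontgomeryZeroSideProofs
import Literature.NumberTheory.LFunctions.ZetaZerosProofs

/-!
# The zero side under a Cauchy-kernel majorant (solo-informed, T9a)

Bookkeeping half of the unconditional sampling-energy bound.  If a non-negative weight on the
zeros of `ζ` in the closed critical strip is dominated by a Cauchy kernel centred at a height
`γ₀`,

`F(ρ) ≤ M / (1 + (Im ρ − γ₀)²)`  whenever `0 ≤ Re ρ ≤ 1`,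

then its multiplicity-weighted sum over the truncated zero index of the Weil explicit formula is
bounded uniformly in the truncation height:

`∑_{ρ ∈ weilZeroIndex T} m(ρ) F(ρ) ≤ 2 A₁ M log(|γ₀| + 2)`  for every `T`,

with the absolute constant `A₁` of the tree's density lemma
`Montgomery.exists_density_le` (`∑_n 1/(1+(t−γ_n)²) ≤ A₁ log(|t|+2)`, a consequence of the
Riemann–von Mangoldt formula; Goldston 2005 (2.18)).  The passage from the boxes
`zetaZeroBox 0 T` with multiplicities to the enumeration `γ_n` is the tree's dictionary
`Montgomery.finsum_zetaZeroBox_mul_eq_sum_range`; the conjugate half of `weilZeroIndex T` is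
handled by `m(ρ̄) = m(ρ)` (`riemannZetaZeroOrder_conj_holds`) and the kernel centred at `−γ₀`.

Main result: `exists_finsum_weilZeroIndex_le_of_kernel_bound`.  No hypothesis on the zeros.
-/

open Complex Set Filter Topology Literature.NumberTheory.LFunctions
open scoped ComplexConjugate

namespace Summit.RiemannHypothesis.RiemannHypothesis.Theorems

/-- The box `zetaZeroBox 0 T` and its conjugate are disjoint (ordinates `> 0` versus `< 0`). -/
theorem disjoint_zetaZeroBox_conj (T : ℝ) :
    Disjoint (zetaZeroBox 0 T) ((starRingEnd ℂ) '' zetaZeroBox 0 T) := by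
  rw [Set.disjoint_left]
  rintro ρ ⟨-, -, -, hpos, -⟩ ⟨ρ', ⟨-, -, -, hpos', -⟩, rfl⟩
  simp only [Complex.conj_im] at hpos
  linarith

/-- **Box sums under a Cauchy majorant.** For the box `0 < Im ρ ≤ T` with multiplicities:
if `G ρ ≤ M/(1+(Im ρ − t)²)` on the box (`M ≥ 0`) then
`∑_{ρ ∈ box} m(ρ) G(ρ) ≤ M · ∑' n, 1/(1+(t−γ_n)²)`. -/
theorem finsum_zetaZeroBox_le_of_kernel_bound {G : ℂ → ℝ} {M t : ℝ} (T : ℝ) (hM : 0 ≤ M)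
    (hG : ∀ ρ ∈ zetaZeroBox 0 T, G ρ ≤ M / (1 + (ρ.im - t) ^ 2))
    (hsum : Summable fun n : ℕ ↦ 1 / (1 + (t - zetaOrdinate n) ^ 2)) :
    ∑ᶠ ρ ∈ zetaZeroBox 0 T, (riemannZetaZeroOrder ρ : ℝ) * G ρ
      ≤ M * ∑' n : ℕ, 1 / (1 + (t - zetaOrdinate n) ^ 2) := by
  classical
  have hfin := zetaZeroBox_finite 0 T
  -- Step 1: replace `G` by the majorant, using `m(ρ) ≥ 0`.
  have hstep1 : ∑ᶠ ρ ∈ zetaZeroBox 0 T, (riemannZetaZeroOrder ρ : ℝ) * G ρ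
      ≤ ∑ᶠ ρ ∈ zetaZeroBox 0 T, (riemannZetaZeroOrder ρ : ℝ) * (M / (1 + (ρ.im - t) ^ 2)) := by
    rw [finsum_mem_eq_finite_toFinset_sum _ hfin, finsum_mem_eq_finite_toFinset_sum _ hfin]
    refine Finset.sum_le_sum fun ρ hρ ↦ ?_
    have hρ' : ρ ∈ zetaZeroBox 0 T := (Set.Finite.mem_toFinset _).1 hρ
    have hne : ρ ≠ 1 := by
      rintro rfl
      have := hρ'.2.2.2.1
      simp at this
    have hm : (0 : ℝ) ≤ riemannZetaZeroOrder ρ := by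
      exact_mod_cast riemannZetaZeroOrder_nonneg hne
    exact mul_le_mul_of_nonneg_left (hG ρ hρ') hm
  -- Step 2: the dictionary `box ↔ enumeration`, real version.
  have hdict := Montgomery.finsum_zetaZeroBox_mul_eq_sum_range
    (fun y : ℝ ↦ ((M / (1 + (y - t) ^ 2) : ℝ) : ℂ)) T
  have hdictR : ∑ᶠ ρ ∈ zetaZeroBox 0 T, (riemannZetaZeroOrder ρ : ℝ) * (M / (1 + (ρ.im - t) ^ 2))
      = ∑ n ∈ Finset.range (zetaZeroCount T), M / (1 + (zetaOrdinate n - t) ^ 2) := by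
    rw [finsum_mem_eq_finite_toFinset_sum _ hfin] at hdict ⊢
    exact_mod_cast hdict
  -- Step 3: finite sum ≤ full series.
  have hstep3 : ∑ n ∈ Finset.range (zetaZeroCount T), M / (1 + (zetaOrdinate n - t) ^ 2)
      ≤ M * ∑' n : ℕ, 1 / (1 + (t - zetaOrdinate n) ^ 2) := by
    have heq : ∀ n, M / (1 + (zetaOrdinate n - t) ^ 2)
        = M * (1 / (1 + (t - zetaOrdinate n) ^ 2)) := by
      intro n
      rw [show (zetaOrdinate n - t) ^ 2 = (t - zetaOrdinate n) ^ 2 by ring]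
      ring
    simp_rw [heq, ← Finset.mul_sum]
    exact mul_le_mul_of_nonneg_left
      (Summable.sum_le_tsum _ (fun n _ ↦ by positivity) hsum) hM
  exact hstep1.trans (hdictR.le.trans hstep3)

/-- **The zero side under a Cauchy majorant (T9a).** There is an absolute constant `A₁ > 0`
such that for every weight `F` on `ℂ` and `M ≥ 0`, `γ₀ ∈ ℝ` with
`F ρ ≤ M/(1+(Im ρ − γ₀)²)` on the closed critical strip, and every truncation height `T`:
`∑_{ρ ∈ weilZeroIndex T} m(ρ) F(ρ) ≤ 2 A₁ M log(|γ₀|+2)`. -/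
theorem exists_finsum_weilZeroIndex_le_of_kernel_bound :
    ∃ A₁ : ℝ, 0 < A₁ ∧ ∀ (F : ℂ → ℝ) (M γ₀ : ℝ), 0 ≤ M →
      (∀ ρ : ℂ, 0 ≤ ρ.re → ρ.re ≤ 1 → F ρ ≤ M / (1 + (ρ.im - γ₀) ^ 2)) →
      ∀ T : ℝ, ∑ᶠ ρ ∈ weilZeroIndex T, (riemannZetaZeroOrder ρ : ℝ) * F ρ
        ≤ 2 * A₁ * M * Real.log (|γ₀| + 2) := by
  obtain ⟨A₁, hA₁, hD⟩ := Montgomery.exists_density_le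
  refine ⟨A₁, hA₁, fun F M γ₀ hM hF T ↦ ?_⟩
  have hfin := zetaZeroBox_finite 0 T
  have hfin' : ((starRingEnd ℂ) '' zetaZeroBox 0 T).Finite := hfin.image _
  rw [weilZeroIndex_eq_union, finsum_mem_union (disjoint_zetaZeroBox_conj T) hfin hfin']
  have hconj : ∀ ρ : ℂ, riemannZetaZeroOrder ((starRingEnd ℂ) ρ) = riemannZetaZeroOrder ρ :=
    riemannZetaZeroOrder_conj_holds
  -- the box `0 < Im ρ ≤ T`
  have h1 : ∑ᶠ ρ ∈ zetaZeroBox 0 T, (riemannZetaZeroOrder ρ : ℝ) * F ρ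
      ≤ M * (A₁ * Real.log (|γ₀| + 2)) := by
    have hG : ∀ ρ ∈ zetaZeroBox 0 T, F ρ ≤ M / (1 + (ρ.im - γ₀) ^ 2) :=
      fun ρ hρ ↦ hF ρ hρ.2.1 hρ.2.2.1
    exact (finsum_zetaZeroBox_le_of_kernel_bound T hM hG (hD γ₀).1).trans
      (mul_le_mul_of_nonneg_left (hD γ₀).2 hM)
  -- the conjugate box `−T ≤ Im ρ < 0`, via `m(ρ̄) = m(ρ)` and the kernel centred at `−γ₀`
  have h2 : ∑ᶠ ρ ∈ (starRingEnd ℂ) '' zetaZeroBox 0 T, (riemannZetaZeroOrder ρ : ℝ) * F ρ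
      ≤ M * (A₁ * Real.log (|γ₀| + 2)) := by
    rw [finsum_mem_image fun x _ y _ h ↦ (starRingEnd ℂ).injective h]
    simp_rw [hconj]
    have hG : ∀ ρ ∈ zetaZeroBox 0 T, F ((starRingEnd ℂ) ρ) ≤ M / (1 + (ρ.im - -γ₀) ^ 2) := by
      intro ρ hρ
      have h := hF ((starRingEnd ℂ) ρ) (by simpa using hρ.2.1) (by simpa using hρ.2.2.1)
      rw [Complex.conj_im, show (-ρ.im - γ₀) ^ 2 = (ρ.im - -γ₀) ^ 2 by ring] at h
      exact h
    have h := finsum_zetaZeroBox_le_of_kernel_bound (G := fun ρ ↦ F ((starRingEnd ℂ) ρ)) T hM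
      hG (hD (-γ₀)).1
    refine h.trans ?_
    have h' := mul_le_mul_of_nonneg_left (hD (-γ₀)).2 hM
    rwa [abs_neg] at h'
  calc ∑ᶠ ρ ∈ zetaZeroBox 0 T, (riemannZetaZeroOrder ρ : ℝ) * F ρ
        + ∑ᶠ ρ ∈ (starRingEnd ℂ) '' zetaZeroBox 0 T, (riemannZetaZeroOrder ρ : ℝ) * F ρ
      ≤ M * (A₁ * Real.log (|γ₀| + 2)) + M * (A₁ * Real.log (|γ₀| + 2)) := add_le_add h1 h2
    _ = 2 * A₁ * M * Real.log (|γ₀| + 2) := by ring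

end Summit.RiemannHypothesis.RiemannHypothesis.Theorems
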